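import Summits.ABC.IUTFork.Thm311RealInd1StripRigid
import Summits.ABC.IUTFork.Thm311RealInd1StripSignature
import Summits.ABC.IUTFork.Thm311RealGaloisLogAnalytic
import HarnessLib

/-!
# [IUTchIII] Thm. 3.11 (i) (Ind1)/(Ind2), print-literal at `𝕍^non`: [IUTchII] Remark 1.8.1 IN FULL at the real log-shell —
# print's (Ind1) strip part meets print's (Ind2) ONLY in the identity (analytic binder)

PROOF-ONLY file (abc-iut cell, WAVE-5 seat abc-iut-w5-d216 gen 5; by-name sequel of abc-iut-c312-1's R9 files
`Thm311RealInd1Strip` / `Thm311RealInd1StripRigid` / `Thm311RealInd1StripSignature` (gen 8) and of this lineage's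
`Thm311RealGaloisLogAnalytic` (p452975: `galoisLog_eq_analyticLogv`, `ismIsm_analyticLogv_eq_unitScalars`)); TAKES NO SIDE on
[IUTchIII] Cor. 3.12.

abc-iut-c312-1 proved its scalar exclusions for print's (Ind1) strip part — no integer scalar `m ≠ 1`, `−1 ∉`, and [IUTchII]
Rmk. 1.8.1 «no automorphism of `O^{×μ}(G)` induced by an element of `Aut(G)` … coincides with an automorphism … induced by an
element of `Ẑ^×` that has nontrivial image in `ℤ_p^×`» (`padicUnitScalar_eq_one_of_mem_ind1StripOf`) — for the GALOIS logarithm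
binder `Real.galoisLog v`.  Since THE Galois logarithm IS c312-5's analytic one (`galoisLog_eq_analyticLogv`), all of them hold for
the binder `Real.analyticLogv F v` of the cell's real signatures (§1).  And since print's (Ind2)-group at `v` through that logarithm
is EXACTLY the unit scalars `ℤ_p^× = χ_p(Ẑ^×)` (`ismIsm_analyticLogv_eq_unitScalars`), Rmk. 1.8.1 becomes a statement about the
WHOLE of print's (Ind2) (§§2–3):

* `Real.ind1StripOf_galoisLog_eq`, `Real.ind1Strip`-level transfers: `Real.eq_one_of_zsmul_mem_ind1StripOf_analyticLogv`,
  `Real.neg_not_mem_ind1StripOf_analyticLogv`, `Real.padicUnitScalar_eq_one_of_mem_ind1StripOf_analyticLogv`,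
  `Real.mulPadicUnitScalar_eq_refl_of_mem_ind1StripOf_analyticLogv`;
* `Real.exists_eq_mulPadicUnitScalar_of_mem_ismIsm_analyticLogv` / `…_of_mem_ismIsmOf_analyticLogv` — every element of print's
  (Ind2) at `v` (c312-1's `ℚ`-linear / additive readings) IS `χ_p(û)·(−)` for some `û ∈ Ẑ^×`;
* **`Real.ind1Strip_inter_ismIsm_analyticLogv_eq`** — `Real.ind1Strip (analyticLogv F) v ∩ Real.ismIsm (analyticLogv F) v = {1}`:
  PRINT'S (Ind1) STRIP PART AND PRINT'S (Ind2) AT A FINITE PLACE MEET ONLY IN THE IDENTITY ([IUTchII] Rmk. 1.8.1 on the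
  `G_v`-invariant part, for the full `Ism`-image rather than only its named `Ẑ^×`-elements); additive forms `Real.ind1StripOf_inter_ismIsmOf_analyticLogv_eq` /
  `Real.ind1StripOf_inter_ismIsmOf_galoisLog_eq`; `Real.neg_not_mem_ind1Strip_analyticLogv`
  (`−1`, an element of print's (Ind2) and of Dupuy–Hilado's `Aut_{ℚ_p}(K_v : I_v)`, is NOT a strip automorphism).

HONEST SCOPE: statements about OUR typed objects (c312-1's realisation predicates for the strip part and for `Ism(G_v)`, with
topologies suppressed as abc-iut-L6-t2 typed `Ism`; the analytic = Galois `p_v`-adic logarithm); the capsule-index permutations of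
(Ind1), (Ind3) and Cor. 3.12 itself are untouched; nothing here asserts that abc is proved or refuted.
[claim: Mochizuki2012, status: disputed] for every [IUTchII]/[IUTchIII] quotation; [cite: MochizukiAbsTopIII2015, Proposition 3.2 (iv) p.72];
[cite: MochizukiAbsAnab2004, Prop 1.2.1 (vi) p.10]; [cite: DupuyHilado2025, §4.9].  Axioms: standard three.
-/

set_option autoImplicit false

noncomputable section

open Metric Set

namespace Summit.ABC.IUTFork.Thm311.Real

open NumberField IsDedekindDomain Literature.IUT.LogVolume Literature.IUT.LogThetaLattice
open Literature.NumberTheory.NumberFields Literature.AnabelianGeometry.AbsoluteAnabelian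
open Literature.NumberTheory.GaloisRepresentations Literature.IUT.HodgeArakelov Literature.AnabelianGeometry.EtaleTheta

variable {F : Type} [Field F] [NumberField F] (v : HeightOneSpectrum (𝓞 F))

/-! ## 1. c312-1's Galois-binder theorems, for the analytic binder -/

/-- Print's (Ind1) strip part at `v` through the Galois logarithm is the one through the analytic logarithm
(`galoisLog_eq_analyticLogv`). [claim: Mochizuki2012, status: disputed] -/
theorem ind1StripOf_galoisLog_eq : ind1StripOf v (galoisLog v) = ind1StripOf v (analyticLogv F v) := by
  rw [galoisLog_eq_analyticLogv]

section Scalars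

variable [Fact (closureAt v).residueChar.Prime]

/-- **No integer scalar `m ≠ 1` lies in print's (Ind1) strip part** (analytic logarithm; c312-1's
`eq_one_of_zsmul_mem_ind1StripOf` transported). [claim: Mochizuki2012, status: disputed] -/
theorem eq_one_of_zsmul_mem_ind1StripOf_analyticLogv {ψ : v.adicCompletion F ≃+ v.adicCompletion F} (m : ℤ)
    (hψm : ∀ a, ψ a = m • a) (hψ : ψ ∈ ind1StripOf v (analyticLogv F v)) : m = 1 :=
  eq_one_of_zsmul_mem_ind1StripOf v m hψm (by rwa [ind1StripOf_galoisLog_eq])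

/-- **`−1 ∉ Real.ind1StripOf v (analyticLogv F v)`**: the inversion — an element of print's (Ind2) (`neg_mem_ismIsmOf`) and of
Dupuy–Hilado's `Aut_{ℚ_p}(K_v : I_v)` — is NOT a strip automorphism (analytic logarithm; c312-1's `neg_not_mem_ind1StripOf`
transported). [claim: Mochizuki2012, status: disputed] -/
theorem neg_not_mem_ind1StripOf_analyticLogv : AddEquiv.neg (v.adicCompletion F) ∉ ind1StripOf v (analyticLogv F v) := by
  rw [← ind1StripOf_galoisLog_eq]
  exact neg_not_mem_ind1StripOf v

/-- **[IUTchII] Rmk. 1.8.1 at the real log-shell, analytic logarithm**: if the `Ẑ^×`-scalar `χ_p(û)·(−)` lies in print's (Ind1)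
strip part then `χ_p(û) = 1` in `K_v` (c312-1's `padicUnitScalar_eq_one_of_mem_ind1StripOf` transported).
[claim: Mochizuki2012, status: disputed] -/
theorem padicUnitScalar_eq_one_of_mem_ind1StripOf_analyticLogv (û : ZHatUnits)
    (h : mulPadicUnitScalar v û ∈ ind1StripOf v (analyticLogv F v)) : padicUnitScalar v û = 1 :=
  padicUnitScalar_eq_one_of_mem_ind1StripOf v û (by rwa [ind1StripOf_galoisLog_eq])

/-- Hence such a scalar acts trivially (analytic logarithm). [claim: Mochizuki2012, status: disputed] -/
theorem mulPadicUnitScalar_eq_refl_of_mem_ind1StripOf_analyticLogv (û : ZHatUnits)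
    (h : mulPadicUnitScalar v û ∈ ind1StripOf v (analyticLogv F v)) :
    mulPadicUnitScalar v û = AddEquiv.refl (v.adicCompletion F) :=
  mulPadicUnitScalar_eq_refl_of_mem_ind1StripOf v û (by rwa [ind1StripOf_galoisLog_eq])

/-- On c312-5's carrier: `−1 ∉ Real.ind1Strip (analyticLogv F) v` (c312-1's `ℚ`-linear strip slot of `Real.logShellsPrint`).
[claim: Mochizuki2012, status: disputed] -/
theorem neg_not_mem_ind1Strip_analyticLogv : LinearEquiv.neg ℚ ∉ ind1Strip (analyticLogv F) v :=
  neg_not_mem_ind1StripOf_analyticLogv v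

end Scalars

/-! ## 2. Every element of print's (Ind2) at `v` is a `Ẑ^×`-scalar -/

section Ind2

variable [Fact (closureAt v).residueChar.Prime]

/-- A `ℚ`-linear automorphism of `K_v` that is multiplication by `c ∈ ℚ_p` (read in `K_v^{(1/n_v)}`) with `χ_p(û) = c` IS
`mulPadicUnitScalar v û` as an additive automorphism. [folklore] -/
theorem toAddEquiv_eq_mulPadicUnitScalar_of_forall_eq_smul
    (hv : (((closureAt v).residueChar : ℕ) : 𝓞 F) ∈ v.asIdeal)
    (ψ : Carrier (.inr v : Place F) ≃ₗ[ℚ] Carrier (.inr v : Place F)) (c : ℚ_[(closureAt v).residueChar]) (û : ZHatUnits)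
    (hû : ((ZHatLevel.padicChar (closureAt v).residueChar û : ℤ_[(closureAt v).residueChar]) :
      ℚ_[(closureAt v).residueChar]) = c)
    (hc : ∀ a : Carrier (.inr v : Place F),
      RescaledCompletion.of F (closureAt v).residueChar v hv (ψ a) =
        c • RescaledCompletion.of F (closureAt v).residueChar v hv a) :
    (ψ.toAddEquiv : v.adicCompletion F ≃+ v.adicCompletion F) = mulPadicUnitScalar v û := by
  haveI : CharZero (v.adicCompletion F) := charZero_adicCompletion v
  -- the scalar `c`, through the canonical `ℚ_p → K_v`, is `χ_p(û)` read in `K_v`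
  have hscalar : (letI := LocalField.adicCompletionPadicAlgebra v (closureAt v).residueChar hv
      algebraMap ℚ_[(closureAt v).residueChar] (v.adicCompletion F) c) = padicUnitScalar v û := by
    change LocalField.padicRingHom (v.adicCompletion F) (closureAt v).residueChar _ c =
      LocalField.padicRingHom (v.adicCompletion F) (closureAt v).residueChar _
        ((ZHatLevel.padicChar (closureAt v).residueChar û : ℤ_[(closureAt v).residueChar]) :
          ℚ_[(closureAt v).residueChar])
    rw [hû]
  refine AddEquiv.ext fun a => ?_
  have ha := hc a
  change RescaledCompletion.of F _ v hv (ψ a) =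
    algebraMap ℚ_[(closureAt v).residueChar] (RescaledCompletion F _ v hv) c * RescaledCompletion.of F _ v hv a at ha
  rw [RescaledCompletion.algebraMap_eq, ← map_mul] at ha
  have ha' := (RescaledCompletion.of F _ v hv).injective ha
  exact ha'.trans (congrArg (· * a) hscalar)

/-- **Every element of print's (Ind2)-group at `v` IS a `Ẑ^×`-scalar**: for `ψ ∈ Real.ismIsm (analyticLogv F) v` there is
`û ∈ Ẑ^×` with `ψ = χ_p(û)·(−)` on `K_v` — Mochizuki's «`Ẑ^× ↠ ℤ_p^× ↪ Ism`» read on the real log-shell is ONTO the typed group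
(this lineage's `exists_unit_scalar_of_mem_ismIsm_analyticLogv` p445977 + `ZHatLevel.padicChar_surjective_units`).
[claim: Mochizuki2012, status: disputed] [cite: RibesZalesskii2010, Thm 2.7.1] -/
theorem exists_eq_mulPadicUnitScalar_of_mem_ismIsm_analyticLogv
    {ψ : Carrier (.inr v : Place F) ≃ₗ[ℚ] Carrier (.inr v : Place F)} (hψ : ψ ∈ ismIsm (analyticLogv F) v) :
    ∃ û : ZHatUnits, (ψ.toAddEquiv : v.adicCompletion F ≃+ v.adicCompletion F) = mulPadicUnitScalar v û := by
  have hv := natCast_residueChar_closureAt_mem v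
  obtain ⟨c, hc1, hc⟩ := exists_unit_scalar_of_mem_ismIsm_analyticLogv (closureAt v).residueChar v hv hψ
  obtain ⟨û, hû⟩ := ZHatLevel.padicChar_surjective_units (closureAt v).residueChar (PadicInt.mkUnits hc1)
  refine ⟨û, toAddEquiv_eq_mulPadicUnitScalar_of_forall_eq_smul v hv ψ c û ?_ hc⟩
  rw [hû]
  rfl

/-- The same for c312-1's ADDITIVE (Ind2)-group `Real.ismIsmOf v (analyticLogv F v)`: every bicontinuous additive automorphism of
`K_v` realising a `G_v`-isometry through the analytic logarithm IS `χ_p(û)·(−)` for some `û ∈ Ẑ^×` (additive automorphisms of the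
`ℚ`-vector space `K_v` are `ℚ`-linear). [claim: Mochizuki2012, status: disputed] [cite: RibesZalesskii2010, Thm 2.7.1] -/
theorem exists_eq_mulPadicUnitScalar_of_mem_ismIsmOf_analyticLogv {ψ : v.adicCompletion F ≃+ v.adicCompletion F}
    (hψ : ψ ∈ ismIsmOf v (analyticLogv F v)) : ∃ û : ZHatUnits, ψ = mulPadicUnitScalar v û := by
  -- the `ℚ`-linear reading of `ψ` on c312-5's carrier (additive ⟹ `ℚ`-linear, `map_rat_smul`)
  let ψC : Carrier (.inr v : Place F) →+ Carrier (.inr v : Place F) :=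
    { toFun := fun a => ψ a
      map_zero' := map_zero ψ
      map_add' := fun a b => map_add ψ a b }
  let ψℚ : Carrier (.inr v : Place F) ≃ₗ[ℚ] Carrier (.inr v : Place F) :=
    { toFun := fun a => ψ a
      map_add' := fun a b => map_add ψ a b
      map_smul' := fun c a => map_rat_smul ψC c a
      invFun := fun a => ψ.symm a
      left_inv := fun a => ψ.symm_apply_apply a
      right_inv := fun a => ψ.apply_symm_apply a }
  have hmem : ψℚ ∈ ismIsm (analyticLogv F) v := by
    rw [mem_ismIsm_iff]
    have hto : (ψℚ.toAddEquiv : v.adicCompletion F ≃+ v.adicCompletion F) = ψ := AddEquiv.ext fun _ => rfl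
    rw [hto]
    exact hψ
  obtain ⟨û, hû⟩ := exists_eq_mulPadicUnitScalar_of_mem_ismIsm_analyticLogv v hmem
  refine ⟨û, AddEquiv.ext fun a => ?_⟩
  have ha := AddEquiv.congr_fun hû a
  exact ha

end Ind2

/-! ## 3. [IUTchII] Remark 1.8.1 in full: (Ind1)-strip ∩ (Ind2) = {1} at every finite place -/

section Rmk181

variable [Fact (closureAt v).residueChar.Prime]

/-- **An element of print's (Ind2) at `v` that is ALSO a strip automorphism is the identity** (analytic logarithm):
`ψ ∈ Real.ismIsm ∩ Real.ind1Strip ⟹ ψ = 1`.  Proof: `ψ = χ_p(û)·(−)` (§2) and `χ_p(û) = 1` (Rmk. 1.8.1, §1).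
[claim: Mochizuki2012, status: disputed] -/
theorem eq_refl_of_mem_ismIsm_of_mem_ind1Strip_analyticLogv
    {ψ : Carrier (.inr v : Place F) ≃ₗ[ℚ] Carrier (.inr v : Place F)}
    (hI : ψ ∈ ismIsm (analyticLogv F) v) (hS : ψ ∈ ind1Strip (analyticLogv F) v) :
    ψ = LinearEquiv.refl ℚ (Carrier (.inr v : Place F)) := by
  obtain ⟨û, hû⟩ := exists_eq_mulPadicUnitScalar_of_mem_ismIsm_analyticLogv v hI
  have hS' : mulPadicUnitScalar v û ∈ ind1StripOf v (analyticLogv F v) := by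
    rw [← hû]
    exact hS
  have h1 := mulPadicUnitScalar_eq_refl_of_mem_ind1StripOf_analyticLogv v û hS'
  refine LinearEquiv.ext fun a => ?_
  have h2 : (ψ.toAddEquiv : v.adicCompletion F ≃+ v.adicCompletion F) a = a := by
    rw [hû, h1]
    rfl
  exact h2

/-- **[IUTchII] REMARK 1.8.1 IN FULL AT THE REAL LOG-SHELL**: print's (Ind1) strip part and print's (Ind2)-group at a finite place
`v` (c312-1's `Real.ind1Strip` / `Real.ismIsm`, both through THE `p_v`-adic logarithm) MEET ONLY IN THE IDENTITY:
`Real.ind1Strip (analyticLogv F) v ∩ Real.ismIsm (analyticLogv F) v = {1}`.  ([IUTchII] Rmk. 1.8.1: «no automorphism of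
`O^{×μ}(G)` induced by an element of `Aut(G)` … coincides with an automorphism of `O^{×μ}(G)` induced by an element of `Γ` that has
nontrivial image in `ℤ_p^×`»; here for EVERY element of `Ism(G_v)`'s image on `K_v`, that image being exactly `ℤ_p^×`.)
[claim: Mochizuki2012, status: disputed] -/
theorem ind1Strip_inter_ismIsm_analyticLogv_eq :
    ind1Strip (analyticLogv F) v ∩ ismIsm (analyticLogv F) v = {LinearEquiv.refl ℚ (Carrier (.inr v : Place F))} := by
  apply Set.Subset.antisymm
  · rintro ψ ⟨hS, hI⟩
    exact eq_refl_of_mem_ismIsm_of_mem_ind1Strip_analyticLogv v hI hS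
  · rintro ψ hψ
    rw [Set.mem_singleton_iff] at hψ
    subst hψ
    exact ⟨refl_mem_ind1Strip (analyticLogv F) v, refl_mem_ismIsm (analyticLogv F) v⟩

/-- The `Ẑ^×`-scalars that are strip automorphisms are exactly those acting trivially: `χ_p(û)·(−) ∈ Real.ind1StripOf ⟺ χ_p(û) = 1`
in `K_v` (analytic logarithm). [claim: Mochizuki2012, status: disputed] -/
theorem mulPadicUnitScalar_mem_ind1StripOf_analyticLogv_iff (û : ZHatUnits) :
    mulPadicUnitScalar v û ∈ ind1StripOf v (analyticLogv F v) ↔ padicUnitScalar v û = 1 := by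
  refine ⟨padicUnitScalar_eq_one_of_mem_ind1StripOf_analyticLogv v û, fun h => ?_⟩
  have heq : mulPadicUnitScalar v û = AddEquiv.refl (v.adicCompletion F) := by
    apply AddEquiv.ext
    intro a
    rw [mulPadicUnitScalar_apply, h, one_mul]
    rfl
  rw [heq]
  exact refl_mem_ind1StripOf v (analyticLogv F v)

/-- **[IUTchII] Rmk. 1.8.1 in full, ADDITIVE form** (c312-1's `AddEquiv`-level sets, analytic logarithm):
`Real.ind1StripOf v (analyticLogv F v) ∩ Real.ismIsmOf v (analyticLogv F v) = {1}`. [claim: Mochizuki2012, status: disputed] -/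
theorem ind1StripOf_inter_ismIsmOf_analyticLogv_eq :
    ind1StripOf v (analyticLogv F v) ∩ ismIsmOf v (analyticLogv F v) = {AddEquiv.refl (v.adicCompletion F)} := by
  apply Set.Subset.antisymm
  · rintro ψ ⟨hS, hI⟩
    obtain ⟨û, rfl⟩ := exists_eq_mulPadicUnitScalar_of_mem_ismIsmOf_analyticLogv v hI
    exact mulPadicUnitScalar_eq_refl_of_mem_ind1StripOf_analyticLogv v û hS
  · rintro ψ hψ
    rw [Set.mem_singleton_iff] at hψ
    subst hψ
    exact ⟨refl_mem_ind1StripOf v _, refl_mem_ismIsmOf v _⟩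

/-- The same for the GALOIS logarithm binder of c312-1's R8/R9 files (`galoisLog_eq_analyticLogv`).
[claim: Mochizuki2012, status: disputed] -/
theorem ind1StripOf_inter_ismIsmOf_galoisLog_eq :
    ind1StripOf v (galoisLog v) ∩ ismIsmOf v (galoisLog v) = {AddEquiv.refl (v.adicCompletion F)} := by
  rw [ind1StripOf_galoisLog_eq, ismIsmOf_galoisLog_eq]
  exact ind1StripOf_inter_ismIsmOf_analyticLogv_eq v

end Rmk181

end Summit.ABC.IUTFork.Thm311.Real

end
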